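import Summits.Ventures.PercRepro.C025ProfileFourCapEBasis
import Summits.Ventures.PercRepro.C025ProfileFourCapESmall
/-!
# (Cap) OF RULE E — `|S| = 5` with a collinear triple: the payers (night-3 g10)
NIGHT3-G10-CAPE-PROOF.md §4, first part. `S` is a rank-`4` set with five points containing a rank-`2` triple `T₀`.
Then `T₀` is the only rank-`2` triple of `S` (`eq_of_triple`), `S ∖ T₀ = {c, c′}` is a pair of `F_{T₀}` independent
in `M／T₀` (`sdiff_mem_Gfam_of_triple`), the pair `{c, c′}` pays nothing (`wE_top_pair_eq_zero`), and the total on `S`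
is at most the share of `T₀` plus the shares of the three INNER pairs `B ⊂ T₀` plus the shares of the six OUTER pairs
`{x, c}` (`sum_wE_triple_decomp`).
-/
open scoped Matroid
namespace PercRepro
open Set Finset ThmH
section CapETripleA
variable {α : Type} [DecidableEq α] {M : Matroid α} [M.Finite]

/-- Every point of `S` on the line of the triple lies in the triple. -/
theorem mem_triple_of_mem_clF {S T₀ : Finset α} (hS : S ∈ Shadow.levelSet M 4) (h5 : S.card = 5) (hT : T₀ ⊆ S)
    (hTc : T₀.card = 3) (hT2 : M.eRk (T₀ : Set α) = 2) {u : α} (huS : u ∈ S) (hu : u ∈ clF M T₀) : u ∈ T₀ := by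
  obtain ⟨hSg, hS4⟩ := Profile.mem_levelSet.1 hS
  by_contra huT
  -- `S ⊆ cl(T₀ ∪ (S ∖ (T₀ ∪ {u})))`, a set of rank `≤ 2 + |S ∖ (T₀ ∪ {u})|`
  have hsub : (S : Set α) ⊆ M.closure ((T₀ ∪ (S \ insert u T₀) : Finset α) : Set α) := by
    intro w hw
    rw [Finset.mem_coe] at hw
    have hE : ((T₀ ∪ (S \ insert u T₀) : Finset α) : Set α) ⊆ M.E := by
      rw [← coe_gr]; exact_mod_cast Finset.union_subset (hT.trans hSg) (Finset.sdiff_subset.trans hSg)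
    by_cases hwu : w = u
    · subst hwu
      have h1 : w ∈ M.closure (T₀ : Set α) := by rw [← Finset.mem_coe, coe_clF] at hu; exact hu
      exact M.closure_subset_closure (by rw [Finset.coe_union]; exact Set.subset_union_left) h1
    · apply M.subset_closure _ hE
      rw [Finset.mem_coe, Finset.mem_union, Finset.mem_sdiff, Finset.mem_insert]
      by_cases hwT : w ∈ T₀
      · exact Or.inl hwT
      · exact Or.inr ⟨hw, fun h => h.elim hwu hwT⟩
  have h1 := M.eRk_mono hsub
  rw [M.eRk_closure_eq, Finset.coe_union] at h1
  have h2 := M.eRk_union_le_eRk_add_eRk (T₀ : Set α) ((S \ insert u T₀ : Finset α) : Set α)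
  have h3 := eRk_le_card (M := M) (S \ insert u T₀)
  have hc : (S \ insert u T₀).card ≤ 1 := by
    rw [Finset.card_sdiff_of_subset (Finset.insert_subset huS hT), Finset.card_insert_of_notMem huT, h5, hTc]
  have h4 : M.eRk (S : Set α) ≤ 3 := by
    refine h1.trans (h2.trans ?_)
    rw [hT2]
    have hc' : M.eRk ((S \ insert u T₀ : Finset α) : Set α) ≤ 1 := h3.trans (by exact_mod_cast hc)
    calc (2 : ℕ∞) + M.eRk ((S \ insert u T₀ : Finset α) : Set α) ≤ 2 + 1 := add_le_add_right hc' 2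
      _ = 3 := by norm_num
  rw [hS4] at h4
  norm_num at h4

/-- The rank-`2` triple of a five-point rank-`4` set is unique. -/
theorem eq_of_triple (hsimple : ∀ T ⊆ M.E, T.encard ≤ 2 → M.Indep T) {S T₀ B : Finset α}
    (hS : S ∈ Shadow.levelSet M 4) (h5 : S.card = 5) (hT : T₀ ⊆ S) (hTc : T₀.card = 3)
    (hT2 : M.eRk (T₀ : Set α) = 2) (hB : B ⊆ S) (hBc : B.card = 3) (hB2 : M.eRk (B : Set α) = 2) : B = T₀ := by
  obtain ⟨hSg, hS4⟩ := Profile.mem_levelSet.1 hS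
  by_cases hint : 2 ≤ (B ∩ T₀).card
  · have hsub : B ⊆ clF M T₀ := subset_clF_of_two_le_card_inter hsimple (hT.trans hSg) (hB.trans hSg) hT2 hB2
      (by rw [Finset.inter_comm]; exact hint)
    have hBT : B ⊆ T₀ := fun u hu => mem_triple_of_mem_clF hS h5 hT hTc hT2 (hB hu) (hsub hu)
    exact Finset.eq_of_subset_of_card_le hBT (by omega)
  · push Not at hint
    have := card_add_card_le_of_inter_le_one hsimple hSg hS4 hB hT hB2 hT2 (by omega)
    omega

/-- `S ∖ T₀` is a pair of `F_{T₀}` independent in `M／T₀`. -/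
theorem sdiff_mem_Gfam_of_triple {S T₀ : Finset α} (hS : S ∈ Shadow.levelSet M 4) (h5 : S.card = 5)
    (hT : T₀ ⊆ S) (hTc : T₀.card = 3) (hT2 : M.eRk (T₀ : Set α) = 2) : S \ T₀ ∈ Gfam M T₀ := by
  obtain ⟨hSg, hS4⟩ := Profile.mem_levelSet.1 hS
  refine mem_Gfam.2 ⟨?_, ?_, ?_⟩
  · intro c hc
    rw [Finset.mem_sdiff] at hc
    exact mem_Fs.2 ⟨hSg hc.1, fun h => hc.2 (mem_triple_of_mem_clF hS h5 hT hTc hT2 hc.1 h)⟩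
  · rw [Finset.card_sdiff_of_subset hT, h5, hTc]
  · rw [Finset.union_sdiff_of_subset hT]; exact hS4

/-- In a simple matroid two different points have rank `2`. -/
theorem eRk_pair_eq_two_of_simple (hsimple : ∀ T ⊆ M.E, T.encard ≤ 2 → M.Indep T) {c c' : α} (hc : c ∈ gr M)
    (hc' : c' ∈ gr M) (hne : c ≠ c') : M.eRk (({c, c'} : Finset α) : Set α) = 2 := by
  have hsub : (({c, c'} : Finset α) : Set α) ⊆ M.E := by
    rw [← coe_gr]
    exact_mod_cast (Finset.insert_subset hc (Finset.singleton_subset_iff.2 hc'))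
  have hI : M.Indep (({c, c'} : Finset α) : Set α) := hsimple _ hsub (by
    rw [Set.encard_coe_eq_coe_finsetCard, Finset.card_pair hne]; rfl)
  rw [hI.eRk_eq_encard, Set.encard_coe_eq_coe_finsetCard, Finset.card_pair hne]; rfl

/-- The pair `S ∖ T₀` pays nothing on `S`. -/
theorem wE_top_pair_eq_zero (hsimple : ∀ T ⊆ M.E, T.encard ≤ 2 → M.Indep T) {S T₀ : Finset α}
    (hS : S ∈ Shadow.levelSet M 4) (h5 : S.card = 5) (hT : T₀ ⊆ S) (hTc : T₀.card = 3)
    (hT2 : M.eRk (T₀ : Set α) = 2) : wE M (S \ T₀) S = 0 := by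
  obtain ⟨hSg, hS4⟩ := Profile.mem_levelSet.1 hS
  set B := S \ T₀ with hB
  have hBc : B.card = 2 := by rw [hB, Finset.card_sdiff_of_subset hT, h5, hTc]
  have hSB : S \ B = T₀ := by rw [hB, Finset.sdiff_sdiff_eq_self hT]
  have hSBc : (S \ B).card = 3 := by rw [hSB, hTc]
  by_cases h4 : 4 ≤ crk M B
  · rw [wE_pair_eq_of_card_three hSBc hBc h4, hSB]
    -- `T₀ ∉ Ls_B`: a point of `T₀` on the line of `B` would give a second rank-`2` triple
    have hL : T₀ ∉ Lfam M B := by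
      intro hL
      obtain ⟨u, huT, hucl, huB⟩ := exists_mem_clF_of_mem_Lfam hL
      have hBg : B ⊆ gr M := Finset.sdiff_subset.trans hSg
      have hB2 : M.eRk (B : Set α) = 2 := by
        obtain ⟨c, c', hcc', hBe⟩ := Finset.card_eq_two.1 hBc
        have hcg : c ∈ gr M := hBg (by rw [hBe]; exact Finset.mem_insert_self _ _)
        have hc'g : c' ∈ gr M := hBg (by rw [hBe]; exact Finset.mem_insert_of_mem (Finset.mem_singleton_self _))
        rw [hBe]
        exact eRk_pair_eq_two_of_simple hsimple hcg hc'g hcc'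
      have hrk : M.eRk ((insert u B : Finset α) : Set α) = 2 := by
        rw [Finset.coe_insert, eRk_insert_eq_of_mem_closure' (by rw [← coe_clF]; exact_mod_cast hucl), hB2]
      have := eq_of_triple hsimple hS h5 hT hTc hT2 (Finset.insert_subset (hT huT) Finset.sdiff_subset)
        (by rw [Finset.card_insert_of_notMem huB, hBc]) hrk
      -- `insert u B = T₀` is impossible: `B` is disjoint from `T₀`
      obtain ⟨c, hc⟩ : ∃ c, c ∈ B := Finset.card_pos.1 (by omega)
      have hcT : c ∈ T₀ := by rw [← this]; exact Finset.mem_insert_of_mem hc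
      exact (Finset.mem_sdiff.1 hc).2 hcT
    -- `T₀ ∉ P_B`: a pair `Y ⊆ T₀` has `ρ(B ∪ Y) = ρ(S) = 4`
    have hP : T₀ ∉ Pfam M B := by
      intro hP
      obtain ⟨_, _, _, Y, hYT, hYc, hY3⟩ := mem_Pfam.1 hP
      have hcl : (T₀ : Set α) ⊆ M.closure (Y : Set α) := by
        obtain ⟨y, y', hyy', rfl⟩ := Finset.card_eq_two.1 hYc
        have := clF_pair_eq_of_subset_line hsimple (hT.trans hSg) hT2 hyy' (hYT (Finset.mem_insert_self _ _))
          (hYT (Finset.mem_insert_of_mem (Finset.mem_singleton_self _)))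
        rw [← coe_clF, this, coe_clF]
        exact M.subset_closure _ (by rw [← coe_gr]; exact_mod_cast hT.trans hSg)
      have hBYE : ((B ∪ Y : Finset α) : Set α) ⊆ M.E := by
        rw [← coe_gr]
        exact_mod_cast Finset.union_subset (Finset.sdiff_subset.trans hSg) ((hYT.trans hT).trans hSg)
      have hScl : (S : Set α) ⊆ M.closure ((B ∪ Y : Finset α) : Set α) := by
        intro w hw
        rw [Finset.mem_coe] at hw
        by_cases hwT : w ∈ T₀
        · exact M.closure_subset_closure (by rw [Finset.coe_union]; exact Set.subset_union_right) (hcl hwT)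
        · apply M.subset_closure _ hBYE
          rw [Finset.mem_coe, Finset.mem_union]; exact Or.inl (Finset.mem_sdiff.2 ⟨hw, hwT⟩)
      have := M.eRk_mono hScl
      rw [M.eRk_closure_eq, hY3, hS4] at this
      norm_num at this
    simp [hL, hP]
  · have h4' : crk M B < 4 := by omega
    simp only [wE, if_pos h4']

/-- **The payers of a five-point set with a collinear triple**: the triple, its three inner pairs, the six outer pairs. -/
theorem sum_wE_triple_decomp (hsimple : ∀ T ⊆ M.E, T.encard ≤ 2 → M.Indep T) {S T₀ : Finset α}
    (hS : S ∈ Shadow.levelSet M 4) (h5 : S.card = 5) (hT : T₀ ⊆ S) (hTc : T₀.card = 3)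
    (hT2 : M.eRk (T₀ : Set α) = 2) :
    ∑ B ∈ (Profile.Rq M 2).filter (fun B => B ⊆ S), wE M B S ≤
      wE M T₀ S + ∑ B ∈ T₀.powersetCard 2, wE M B S + ∑ x ∈ T₀, ∑ c ∈ S \ T₀, wE M {x, c} S := by
  obtain ⟨hSg, hS4⟩ := Profile.mem_levelSet.1 hS
  set outer : Finset (Finset α) := (T₀ ×ˢ (S \ T₀)).image (fun p => ({p.1, p.2} : Finset α)) with houter
  set U : Finset (Finset α) := {T₀} ∪ T₀.powersetCard 2 ∪ outer ∪ {S \ T₀} with hU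
  -- the filter lies in `U`
  have hsub : (Profile.Rq M 2).filter (fun B => B ⊆ S) ⊆ U := by
    intro B hB
    rw [Finset.mem_filter] at hB
    obtain ⟨hBg, hB2⟩ := Profile.mem_Rq.1 hB.1
    have hBS := hB.2
    have hge := two_le_card_of_eRk_two hB2
    have hle := card_sdiff_ge_two_of_eRk_two hS4 hB2
    rw [Finset.card_sdiff_of_subset hBS, h5] at hle
    rw [hU, Finset.mem_union, Finset.mem_union, Finset.mem_union, Finset.mem_singleton, Finset.mem_singleton]
    rcases Nat.lt_or_ge B.card 3 with h2 | h3
    · have hBc : B.card = 2 := by omega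
      by_cases hBT : B ⊆ T₀
      · exact Or.inl (Or.inl (Or.inr (Finset.mem_powersetCard.2 ⟨hBT, hBc⟩)))
      · obtain ⟨c, hcB, hcT⟩ := Finset.not_subset.1 hBT
        obtain ⟨a, b, hab, hBe⟩ := Finset.card_eq_two.1 hBc
        have hcab : c = a ∨ c = b := by
          have := hcB; rw [hBe, Finset.mem_insert, Finset.mem_singleton] at this; exact this
        -- the other point
        obtain ⟨x, hxB, hxc, hBe'⟩ : ∃ x, x ∈ B ∧ x ≠ c ∧ B = {x, c} := by
          rcases hcab with rfl | rfl
          · exact ⟨b, by rw [hBe]; exact Finset.mem_insert_of_mem (Finset.mem_singleton_self _), hab.symm,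
              by rw [hBe, Finset.pair_comm]⟩
          · exact ⟨a, by rw [hBe]; exact Finset.mem_insert_self _ _, hab, hBe⟩
        by_cases hxT : x ∈ T₀
        · refine Or.inl (Or.inr ?_)
          rw [houter, Finset.mem_image]
          exact ⟨(x, c), Finset.mem_product.2 ⟨hxT, Finset.mem_sdiff.2 ⟨hBS hcB, hcT⟩⟩, hBe'.symm⟩
        · refine Or.inr ?_
          apply Finset.eq_of_subset_of_card_le
          · intro w hw
            rw [hBe', Finset.mem_insert, Finset.mem_singleton] at hw
            rcases hw with rfl | rfl
            · exact Finset.mem_sdiff.2 ⟨hBS hxB, hxT⟩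
            · exact Finset.mem_sdiff.2 ⟨hBS hcB, hcT⟩
          · rw [Finset.card_sdiff_of_subset hT, h5, hTc, hBc]
    · have hBc : B.card = 3 := by omega
      exact Or.inl (Or.inl (Or.inl (eq_of_triple hsimple hS h5 hT hTc hT2 hBS hBc hB2)))
  -- disjointness of the four pieces
  have hd1 : Disjoint ({T₀} : Finset (Finset α)) (T₀.powersetCard 2) := by
    rw [Finset.disjoint_left]
    intro B hB hB'
    rw [Finset.mem_singleton] at hB
    rw [Finset.mem_powersetCard] at hB'
    rw [hB] at hB'; omega
  have hd2 : Disjoint ({T₀} ∪ T₀.powersetCard 2) outer := by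
    rw [Finset.disjoint_left]
    intro B hB hB'
    rw [houter, Finset.mem_image] at hB'
    obtain ⟨⟨x, c⟩, hp, rfl⟩ := hB'
    rw [Finset.mem_product] at hp
    have hcT : c ∉ T₀ := (Finset.mem_sdiff.1 hp.2).2
    rw [Finset.mem_union, Finset.mem_singleton, Finset.mem_powersetCard] at hB
    rcases hB with hB | hB
    · exact hcT (by rw [← hB]; exact Finset.mem_insert_of_mem (Finset.mem_singleton_self _))
    · exact hcT (hB.1 (Finset.mem_insert_of_mem (Finset.mem_singleton_self _)))
  have hd3 : Disjoint ({T₀} ∪ T₀.powersetCard 2 ∪ outer) {S \ T₀} := by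
    rw [Finset.disjoint_left]
    intro B hB hB'
    rw [Finset.mem_singleton] at hB'
    subst hB'
    rw [Finset.mem_union, Finset.mem_union, Finset.mem_singleton, Finset.mem_powersetCard] at hB
    have hc : (S \ T₀).card = 2 := by rw [Finset.card_sdiff_of_subset hT, h5, hTc]
    rcases hB with (hB | hB) | hB
    · rw [hB, hTc] at hc; omega
    · obtain ⟨c, hc'⟩ : ∃ c, c ∈ S \ T₀ := Finset.card_pos.1 (by omega)
      exact (Finset.mem_sdiff.1 hc').2 (hB.1 hc')
    · rw [houter, Finset.mem_image] at hB
      obtain ⟨⟨x, c⟩, hp, heq⟩ := hB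
      rw [Finset.mem_product] at hp
      have : x ∈ S \ T₀ := by rw [← heq]; exact Finset.mem_insert_self _ _
      exact (Finset.mem_sdiff.1 this).2 hp.1
  have hnn : ∀ B ∈ U, 0 ≤ wE M B S := fun B _ => wE_nonneg B S
  calc ∑ B ∈ (Profile.Rq M 2).filter (fun B => B ⊆ S), wE M B S ≤ ∑ B ∈ U, wE M B S :=
        Finset.sum_le_sum_of_subset_of_nonneg hsub (fun B hB _ => hnn B hB)
    _ = wE M T₀ S + ∑ B ∈ T₀.powersetCard 2, wE M B S + ∑ B ∈ outer, wE M B S + wE M (S \ T₀) S := by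
        rw [hU, Finset.sum_union hd3, Finset.sum_union hd2, Finset.sum_union hd1, Finset.sum_singleton,
          Finset.sum_singleton]
    _ = wE M T₀ S + ∑ B ∈ T₀.powersetCard 2, wE M B S + ∑ x ∈ T₀, ∑ c ∈ S \ T₀, wE M {x, c} S := by
        rw [wE_top_pair_eq_zero hsimple hS h5 hT hTc hT2, add_zero, houter, Finset.sum_image, Finset.sum_product]
        -- injectivity of `(x, c) ↦ {x, c}` on `T₀ × (S ∖ T₀)`
        rintro ⟨x, c⟩ hp ⟨x', c'⟩ hp' heq
        rw [Finset.mem_coe, Finset.mem_product] at hp hp'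
        simp only at heq
        have hx : x ∈ ({x', c'} : Finset α) := by rw [← heq]; exact Finset.mem_insert_self _ _
        have hc : c ∈ ({x', c'} : Finset α) := by
          rw [← heq]; exact Finset.mem_insert_of_mem (Finset.mem_singleton_self _)
        rw [Finset.mem_insert, Finset.mem_singleton] at hx hc
        have hxT := hp.1
        have hcT := (Finset.mem_sdiff.1 hp.2).2
        have hx'T := hp'.1
        have hc'T := (Finset.mem_sdiff.1 hp'.2).2
        rcases hx with rfl | rfl
        · rcases hc with rfl | rfl
          · exact absurd hxT hcT
          · rfl
        · exact absurd hxT hc'T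

end CapETripleA
end PercRepro
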